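import Mathlib
import HarnessLib
import Summits.NavierStokesRegularity.NavierStokesRegularity.Theorems.PoloidalWindowDoorPoloidalWindowRigidityHotHullSlidingHull
import Summits.NavierStokesRegularity.NavierStokesRegularity.Theorems.PoloidalWindowDoorPoloidalWindowRigidityHotHullRecurrence

/-!
# Route `PoloidalWindowDoor`, crux `PoloidalWindowRigidity` (K2, stmt-NavierStokesRegularity-19708) — LINE 21 «hot_hull» v1.5/v1.6 (ns-idea-8 g10):
# H6 `LeafRecurrence` — BIRKHOFF RECURRENCE IN THE SLIDING HULL, VERBATIM (Cruxes-local `Pinned` / `Peakless` / `hotSet` delta-unfolded)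

Cell ns-regularity-ideate, seat ns-poloidal-K2-p2 g14 (K2 stub-worker hand; DIRECTOR-NS #288 conditional key, released by idea-crit-7's PASS of LINE 21
v1.5/v1.6, 06:54Z/06:57Z 2026-08-29).  Statement = `LeafRecurrence` of `Cruxes/PoloidalWindowRigidity/Lines/hot_hull.lean` (v1.6, 93916598275b24d6,
l.1425–1455): a pinned peakless profile `v` with a complete hot leaf `γ` whose end `l ∈ {atTop, atBot}` has end vorticity eventually `≥ δ > 0` admits a
HULL MEMBER `U` of that end (a pinned peakless locally uniform limit of translates `v(·, · + γ(τs k))`, `τs k → l`, vorticity slices converging too)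
whose hot leaf `γ_U` through `0` has `‖ω_U(−1, γ_U σ)‖ ≥ δ` everywhere and is RECURRENT UNDER SLIDING IN BOTH DIRECTIONS with SYNDETIC `(ε, R)`-returns.

PROOF (the line card's, with the tree's Birkhoff–Furstenberg theorem in place of Bhatia–Szegö 2.9.1/2.9.7/2.9.11).
* The SLIDING HULL `Ω` of the end: pinned peakless profiles `U` with times `τs k → l` along which the translates and their vorticity slices converge
  locally uniformly to `U`.  It is non-empty (H3 `…HotHullCompactness.hullLimit` along `γ(k)` resp. `γ(−k)`), consists of class profiles, is invariant
  under sliding along leaves (`…HotHullSlidingHull.sliding_invariant`: re-pinning H1 at the hot leaf point, shifted times `τs k + σ`, the re-based leaves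
  converge by H5) and sequentially compact-and-closed (H3′ `classCompactness` + the diagonal lemma `…HotHullSlidingHull.hull_diagonal`).
* Birkhoff (`…HotHullRecurrence.exists_uniformly_recurrent`): some `U ∈ Ω` returns `(ε, slab)`-close to itself under sliding along a relatively dense
  set of leaf times, for every `ε` and every compact slab — this is the `(ε, R)`-clause, and along the return times `σ_m ≥ m` / `σ_m ≤ −m` of the
  `(1/(m+1), slab m)`-returns the slid profiles converge back to `U` (all slices, the vorticity slice, and — Grönwall, `…HotHullLeafLimit.tendsto_rebased_curves`
  — the re-based leaves): `recurrent_returns`.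
* `‖ω_U(−1, γ_U σ)‖ ≥ δ`: `γ(τs k + σ) − γ(τs k) → γ_U σ` (H5) and `τs k + σ → l`, along which the end vorticity is eventually `≥ δ`.

WHAT THIS IS NOT: not a claim about Navier–Stokes regularity — a support stub (H6, LOAD-BEARING for the cut PERSISTENT-END ⊆ RECURRENT-LEAF ∪ OSCILLATING-END)
of a PASSed research decomposition of ⟨19708⟩'s residues (bears_on LADDER-NS N0, rung N0-LocalTubeDoorPoloidal); the research cells RECURRENT-LEAF /
OSCILLATING-END / NULL-CONTINUUM / CONVERGENT-WEB, S0 and ⟨27893⟩ stay OPEN; crux 19708 / item 20428 OPEN; NS regularity NOT proved.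
-/

noncomputable section

-- the summit and its single sub-problem share the name (CONVENTIONS §1), as in every Theorems file
set_option linter.dupNamespace false

namespace Summit.NavierStokesRegularity.NavierStokesRegularity.Theorems.PoloidalWindowDoorPoloidalWindowRigidityHotHullLeafRecurrence

open Set Function Filter Topology Metric
open scoped InnerProductSpace RealInnerProductSpace Laplacian NNReal
open Literature.Analysis Literature.Analysis.FluidPDE Literature.Analysis.UnboundedOperators
open Summit.NavierStokesRegularity.NavierStokesRegularity.Theorems
open PoloidalWindowDoorPoloidalWindowRigidityHotHullCompactness PoloidalWindowDoorPoloidalWindowRigidityHotHullLeafLimit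
  PoloidalWindowDoorPoloidalWindowRigidityHotHullSlabUniform PoloidalWindowDoorPoloidalWindowRigidityHotHullSliding
  PoloidalWindowDoorPoloidalWindowRigidityHotHullSlidingHull PoloidalWindowDoorPoloidalWindowRigidityHotHullRecurrence
  PoloidalWindowDoorPoloidalWindowRigidityLeafUniformVortexLine

/-- **Returns of the `(1/(m+1), slab m)`-recurrence give convergence back to `U`** — all slices, the vorticity slice, and the re-based leaves. -/
theorem recurrent_returns {U : ℝ → EuclideanSpace ℝ (Fin 3) → EuclideanSpace ℝ (Fin 3)} {γs : ℝ → EuclideanSpace ℝ (Fin 3)} {σs : ℕ → ℝ}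
    {K : ℝ≥0} {B : ℝ} (hK : LipschitzWith K (curl (U (-1)))) (hB : ∀ x, ‖curl (U (-1)) x‖ ≤ B)
    (hγs0 : γs 0 = 0) (hγs : ∀ σ, HasDerivAt γs (curl (U (-1)) (γs σ)) σ)
    (hret : ∀ m : ℕ,
      (∀ t ∈ Icc (-((m : ℝ) + 2)) (-((m : ℝ) + 2)⁻¹), ∀ x ∈ closedBall (0 : EuclideanSpace ℝ (Fin 3)) ((m : ℝ) + 2),
        dist (U t (x + γs (σs m))) (U t x) < 1 / ((m : ℝ) + 1)) ∧
      (∀ x ∈ closedBall (0 : EuclideanSpace ℝ (Fin 3)) ((m : ℝ) + 2),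
        dist (curl (U (-1)) (x + γs (σs m))) (curl (U (-1)) x) < 1 / ((m : ℝ) + 1))) :
    (∀ t < 0, TendstoLocallyUniformly (fun k x => U t (x + γs (σs k))) (U t) Filter.atTop) ∧
      TendstoLocallyUniformly (fun k x => curl (U (-1)) (x + γs (σs k))) (curl (U (-1))) Filter.atTop ∧
      (∀ σ : ℝ, Filter.Tendsto (fun k => γs (σs k + σ) - γs (σs k)) Filter.atTop (nhds (γs σ))) := by
  have hn2 : ∀ n : ℕ, (1 : ℝ) ≤ (n : ℝ) + 2 := fun n => by have := n.cast_nonneg (α := ℝ); linarith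
  -- a uniform `ε`-tail from the `1/(m+1)` rates
  have htail : ∀ ε : ℝ, 0 < ε → ∀ n₀ : ℕ, ∀ᶠ m : ℕ in atTop, n₀ ≤ m ∧ 1 / ((m : ℝ) + 1) < ε := by
    intro ε hε n₀
    obtain ⟨m₁, hm₁⟩ := exists_nat_gt (1 / ε)
    filter_upwards [eventually_ge_atTop (max n₀ m₁)] with m hm
    refine ⟨le_trans (le_max_left _ _) hm, ?_⟩
    have hm' : (m₁ : ℝ) ≤ m := Nat.cast_le.2 (le_trans (le_max_right _ _) hm)
    rw [div_lt_iff₀ (by positivity)]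
    rw [div_lt_iff₀ hε] at hm₁
    nlinarith
  have hslab_mono : ∀ {n m : ℕ}, n ≤ m → ∀ t ∈ Icc (-((n : ℝ) + 2)) (-((n : ℝ) + 2)⁻¹), t ∈ Icc (-((m : ℝ) + 2)) (-((m : ℝ) + 2)⁻¹) := by
    intro n m hnm t ht
    have hnm' : (n : ℝ) + 2 ≤ (m : ℝ) + 2 := by have := Nat.cast_le (α := ℝ).2 hnm; linarith
    refine ⟨by linarith [ht.1], le_trans ht.2 ?_⟩
    rw [neg_le_neg_iff]
    exact inv_anti₀ (by linarith [hn2 n]) hnm'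
  have hball_mono : ∀ {n m : ℕ}, n ≤ m → closedBall (0 : EuclideanSpace ℝ (Fin 3)) ((n : ℝ) + 2) ⊆ closedBall 0 ((m : ℝ) + 2) := by
    intro n m hnm
    have hnm' : (n : ℝ) + 2 ≤ (m : ℝ) + 2 := by have := Nat.cast_le (α := ℝ).2 hnm; linarith
    exact closedBall_subset_closedBall hnm'
  have hcurl : TendstoLocallyUniformly (fun k x => curl (U (-1)) (x + γs (σs k))) (curl (U (-1))) atTop := by
    rw [tendstoLocallyUniformly_iff_forall_isCompact]
    intro Kc hKc
    obtain ⟨r, hr⟩ := hKc.isBounded.subset_closedBall 0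
    obtain ⟨n, hn⟩ := exists_nat_ge r
    have hnr : r ≤ (n : ℝ) + 2 := by linarith
    rw [Metric.tendstoUniformlyOn_iff]
    intro ε hε
    filter_upwards [htail ε hε n] with m hm x hx
    rw [dist_comm]
    exact ((hret m).2 x (hball_mono hm.1 (closedBall_subset_closedBall hnr (hr hx)))).trans hm.2
  refine ⟨fun t ht => ?_, hcurl, fun σ => ?_⟩
  · rw [tendstoLocallyUniformly_iff_forall_isCompact]
    intro Kc hKc
    obtain ⟨r, hr⟩ := hKc.isBounded.subset_closedBall 0
    obtain ⟨n, hn⟩ := exists_nat_ge (max (max r (-t)) (-t)⁻¹)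
    have hnr : r ≤ (n : ℝ) + 2 := by linarith [le_max_left (max r (-t)) (-t)⁻¹, le_max_left r (-t)]
    have ht1 : -((n : ℝ) + 2) ≤ t := by linarith [le_max_left (max r (-t)) (-t)⁻¹, le_max_right r (-t)]
    have ht2 : t ≤ -((n : ℝ) + 2)⁻¹ := by
      have h1 : (-t)⁻¹ ≤ (n : ℝ) + 2 := by linarith [le_max_right (max r (-t)) (-t)⁻¹]
      have h2 : ((n : ℝ) + 2)⁻¹ ≤ -t := inv_le_of_inv_le₀ (by linarith) h1
      linarith
    rw [Metric.tendstoUniformlyOn_iff]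
    intro ε hε
    filter_upwards [htail ε hε n] with m hm x hx
    rw [dist_comm]
    exact ((hret m).1 t (hslab_mono hm.1 t ⟨ht1, ht2⟩) x (hball_mono hm.1 (closedBall_subset_closedBall hnr (hr hx)))).trans hm.2
  · exact tendsto_rebased_curves (X := fun k x => curl (U (-1)) (x + γs (σs k))) (Y := curl (U (-1))) hK (B := B)
      (fun k x => hB _) hcurl (c := fun k σ => γs (σs k + σ) - γs (σs k)) (fun k σ' => hasDerivAt_rebased_leaf hγs (σs k) σ')
      (fun k => rebased_leaf_zero γs (σs k)) hγs hγs0 σ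

/-- **H6 `LeafRecurrence` of LINE 21 «hot_hull» (VERBATIM; `Pinned` / `Peakless` / `hotSet` unfolded).**  See the module docstring. -/
theorem leafRecurrence :
    ∀ (C : ℝ) (v : ℝ → EuclideanSpace ℝ (Fin 3) → EuclideanSpace ℝ (Fin 3)) (γ : ℝ → EuclideanSpace ℝ (Fin 3)) (l : Filter ℝ) (δ : ℝ),
      (Literature.Analysis.FluidPDE.HasTypeITimeDecay C v ∧
        ContinuousOn (Function.uncurry v) (Set.Iio (0 : ℝ) ×ˢ Set.univ) ∧
        (∀ s t : ℝ, s < t → t < 0 → ∀ x, v t x =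
          Literature.Analysis.UnboundedOperators.heatExtension (v s) (t - s) x -
            Literature.Analysis.FluidPDE.oseenDuhamel 1 s v v t x) ∧
        (∀ t < 0, Literature.Analysis.FluidPDE.VectorCalculus.IsDivFree (v t)) ∧
        (∀ s < 0, ∀ y, ⟪Literature.Analysis.FluidPDE.curl (v s) y, EuclideanSpace.single 2 1⟫_ℝ = 0) ∧
        v (-1) 0 2 ≠ 0 ∧ (∀ t < 0, ∀ x, Real.sqrt (-t) * |v t x 2| ≤ |v (-1) 0 2|) ∧
        (∀ h : EuclideanSpace ℝ (Fin 3), fderiv ℝ (v (-1)) 0 h 2 = 0) ∧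
        (deriv (fun s => v s 0 2) (-1) = v (-1) 0 2 / 2 ∧ v (-1) 0 2 * (Δ (fun y => v (-1) y 2)) 0 ≤ 0)) →
      (∀ (s z₀ σ M : ℝ) (K O : Set (EuclideanSpace ℝ (Fin 3))), s < 0 →
        ((σ = 1 ∨ σ = -1) ∧ IsCompact K ∧ K.Nonempty ∧ (∀ y ∈ K, y 2 = z₀ ∧ σ * v s y 2 = M) ∧
          IsOpen O ∧ K ⊆ O ∧ (∀ y ∈ O, y 2 = z₀ → σ * v s y 2 ≤ M) ∧
          (∀ y ∈ O, y 2 = z₀ → σ * v s y 2 = M → y ∈ K)) → False) →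
      (∀ τ : ℝ, HasDerivAt γ (Literature.Analysis.FluidPDE.curl (v (-1)) (γ τ)) τ) → (∀ τ : ℝ, γ τ ∈ {y : EuclideanSpace ℝ (Fin 3) | y 2 = 0 ∧ v (-1) y 2 = v (-1) 0 2}) →
      (l = Filter.atTop ∨ l = Filter.atBot) → Filter.Tendsto γ l (Filter.cocompact _) →
      0 < δ → (∀ᶠ τ in l, δ ≤ ‖Literature.Analysis.FluidPDE.curl (v (-1)) (γ τ)‖) →
      ∃ (U : ℝ → EuclideanSpace ℝ (Fin 3) → EuclideanSpace ℝ (Fin 3)) (γU : ℝ → EuclideanSpace ℝ (Fin 3)) (τs : ℕ → ℝ),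
        Filter.Tendsto τs Filter.atTop l ∧
        (Literature.Analysis.FluidPDE.HasTypeITimeDecay C U ∧
          ContinuousOn (Function.uncurry U) (Set.Iio (0 : ℝ) ×ˢ Set.univ) ∧
          (∀ s t : ℝ, s < t → t < 0 → ∀ x, U t x =
            Literature.Analysis.UnboundedOperators.heatExtension (U s) (t - s) x -
              Literature.Analysis.FluidPDE.oseenDuhamel 1 s U U t x) ∧
          (∀ t < 0, Literature.Analysis.FluidPDE.VectorCalculus.IsDivFree (U t)) ∧
          (∀ s < 0, ∀ y, ⟪Literature.Analysis.FluidPDE.curl (U s) y, EuclideanSpace.single 2 1⟫_ℝ = 0) ∧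
          U (-1) 0 2 ≠ 0 ∧ (∀ t < 0, ∀ x, Real.sqrt (-t) * |U t x 2| ≤ |U (-1) 0 2|) ∧
          (∀ h : EuclideanSpace ℝ (Fin 3), fderiv ℝ (U (-1)) 0 h 2 = 0) ∧
          (deriv (fun s => U s 0 2) (-1) = U (-1) 0 2 / 2 ∧ U (-1) 0 2 * (Δ (fun y => U (-1) y 2)) 0 ≤ 0)) ∧
        (∀ (s z₀ σ M : ℝ) (K O : Set (EuclideanSpace ℝ (Fin 3))), s < 0 →
          ((σ = 1 ∨ σ = -1) ∧ IsCompact K ∧ K.Nonempty ∧ (∀ y ∈ K, y 2 = z₀ ∧ σ * U s y 2 = M) ∧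
            IsOpen O ∧ K ⊆ O ∧ (∀ y ∈ O, y 2 = z₀ → σ * U s y 2 ≤ M) ∧
            (∀ y ∈ O, y 2 = z₀ → σ * U s y 2 = M → y ∈ K)) → False) ∧
        (∀ t < 0, TendstoLocallyUniformly (fun k x => v t (x + γ (τs k))) (U t) Filter.atTop) ∧
        TendstoLocallyUniformly (fun k x => Literature.Analysis.FluidPDE.curl (v (-1)) (x + γ (τs k)))
          (Literature.Analysis.FluidPDE.curl (U (-1))) Filter.atTop ∧
        γU 0 = 0 ∧ (∀ σ : ℝ, HasDerivAt γU (Literature.Analysis.FluidPDE.curl (U (-1)) (γU σ)) σ) ∧ (∀ σ : ℝ, γU σ ∈ {y : EuclideanSpace ℝ (Fin 3) | y 2 = 0 ∧ U (-1) y 2 = U (-1) 0 2}) ∧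
        (∀ σ : ℝ, δ ≤ ‖Literature.Analysis.FluidPDE.curl (U (-1)) (γU σ)‖) ∧
        (∃ σs : ℕ → ℝ, Filter.Tendsto σs Filter.atTop Filter.atTop ∧
          (∀ t < 0, TendstoLocallyUniformly (fun k x => U t (x + γU (σs k))) (U t) Filter.atTop) ∧
          TendstoLocallyUniformly (fun k x => Literature.Analysis.FluidPDE.curl (U (-1)) (x + γU (σs k)))
            (Literature.Analysis.FluidPDE.curl (U (-1))) Filter.atTop ∧
          (∀ σ : ℝ, Filter.Tendsto (fun k => γU (σs k + σ) - γU (σs k)) Filter.atTop (nhds (γU σ)))) ∧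
        (∃ σs : ℕ → ℝ, Filter.Tendsto σs Filter.atTop Filter.atBot ∧
          (∀ t < 0, TendstoLocallyUniformly (fun k x => U t (x + γU (σs k))) (U t) Filter.atTop) ∧
          TendstoLocallyUniformly (fun k x => Literature.Analysis.FluidPDE.curl (U (-1)) (x + γU (σs k)))
            (Literature.Analysis.FluidPDE.curl (U (-1))) Filter.atTop ∧
          (∀ σ : ℝ, Filter.Tendsto (fun k => γU (σs k + σ) - γU (σs k)) Filter.atTop (nhds (γU σ)))) ∧
        (∀ ε : ℝ, 0 < ε → ∀ R : ℝ, 0 < R → ∃ L : ℝ, 0 < L ∧ ∀ a : ℝ, ∃ σ ∈ Set.Icc a (a + L),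
          ∀ t ∈ Set.Icc (-R) (-R⁻¹), ∀ x ∈ Metric.closedBall (0 : EuclideanSpace ℝ (Fin 3)) R,
            dist (U t (x + γU σ)) (U t x) ≤ ε) := by
  intro C v γ l δ hP hpk hγ hhot hl _hesc hδ hpers
  classical
  -- the sliding hull of the end
  set Ω : Set (ℝ → EuclideanSpace ℝ (Fin 3) → EuclideanSpace ℝ (Fin 3)) := {U |
    (Literature.Analysis.FluidPDE.HasTypeITimeDecay C U ∧
      ContinuousOn (Function.uncurry U) (Set.Iio (0 : ℝ) ×ˢ Set.univ) ∧
      (∀ s t : ℝ, s < t → t < 0 → ∀ x, U t x =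
        Literature.Analysis.UnboundedOperators.heatExtension (U s) (t - s) x -
          Literature.Analysis.FluidPDE.oseenDuhamel 1 s U U t x) ∧
      (∀ t < 0, Literature.Analysis.FluidPDE.VectorCalculus.IsDivFree (U t)) ∧
      (∀ s < 0, ∀ y, ⟪Literature.Analysis.FluidPDE.curl (U s) y, EuclideanSpace.single 2 1⟫_ℝ = 0) ∧
      U (-1) 0 2 ≠ 0 ∧ (∀ t < 0, ∀ x, Real.sqrt (-t) * |U t x 2| ≤ |U (-1) 0 2|) ∧
      (∀ h : EuclideanSpace ℝ (Fin 3), fderiv ℝ (U (-1)) 0 h 2 = 0) ∧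
      (deriv (fun s => U s 0 2) (-1) = U (-1) 0 2 / 2 ∧ U (-1) 0 2 * (Δ (fun y => U (-1) y 2)) 0 ≤ 0)) ∧
    (∀ (s z₀ σ M : ℝ) (K O : Set (EuclideanSpace ℝ (Fin 3))), s < 0 →
      ((σ = 1 ∨ σ = -1) ∧ IsCompact K ∧ K.Nonempty ∧ (∀ y ∈ K, y 2 = z₀ ∧ σ * U s y 2 = M) ∧
        IsOpen O ∧ K ⊆ O ∧ (∀ y ∈ O, y 2 = z₀ → σ * U s y 2 ≤ M) ∧
        (∀ y ∈ O, y 2 = z₀ → σ * U s y 2 = M → y ∈ K)) → False) ∧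
    ∃ τs : ℕ → ℝ, Filter.Tendsto τs Filter.atTop l ∧
      (∀ t < 0, TendstoLocallyUniformly (fun k x => v t (x + γ (τs k))) (U t) Filter.atTop) ∧
      TendstoLocallyUniformly (fun k x => curl (v (-1)) (x + γ (τs k))) (curl (U (-1))) Filter.atTop} with hΩ
  -- (Ω1) non-empty: a hull limit along `γ(k)` / `γ(−k)`
  obtain ⟨τ0, hτ0⟩ : ∃ τ0 : ℕ → ℝ, Tendsto τ0 atTop l := by
    rcases hl with rfl | rfl
    · exact ⟨fun k => (k : ℝ), tendsto_natCast_atTop_atTop⟩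
    · exact ⟨fun k => -(k : ℝ), tendsto_neg_atTop_atBot.comp tendsto_natCast_atTop_atTop⟩
  obtain ⟨φ0, U0, hφ0, hPU0, hKU0, hV0, hW0⟩ := hullLimit C v hP hpk (fun k => γ (τ0 k)) (fun k => hhot (τ0 k))
  have hU0 : U0 ∈ Ω := ⟨hPU0, hKU0, fun j => τ0 (φ0 j), hτ0.comp hφ0.tendsto_atTop, hV0, hW0⟩
  -- (Ω2) class
  have hcls : ∀ U ∈ Ω, HasTypeITimeDecay C U ∧ ContinuousOn (uncurry U) (Iio (0 : ℝ) ×ˢ univ) ∧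
      (∀ s t : ℝ, s < t → t < 0 → ∀ x, U t x = heatExtension (U s) (t - s) x - oseenDuhamel 1 s U U t x) ∧
      (∀ t < 0, VectorCalculus.IsDivFree (U t)) := fun U hU => ⟨hU.1.1, hU.1.2.1, hU.1.2.2.1, hU.1.2.2.2.1⟩
  -- (Ω3) sliding invariance
  have hinv : ∀ U ∈ Ω, ∀ γU : ℝ → EuclideanSpace ℝ (Fin 3), γU 0 = 0 → (∀ σ, HasDerivAt γU (curl (U (-1)) (γU σ)) σ) →
      ∀ σ : ℝ, (fun t x => U t (x + γU σ)) ∈ Ω := by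
    rintro U ⟨hPU, hKU, τs, hτs, hVt, hW⟩ γU hγU0 hγU σ
    obtain ⟨hP', hK', hτs', hVt', hW'⟩ := sliding_invariant hl hP hγ hhot hPU hKU hτs hVt hW hγU0 hγU σ
    exact ⟨hP', hK', fun k => τs k + σ, hτs', hVt', hW'⟩
  -- (Ω4) sequential compactness and closedness
  have hcpt : ∀ Us : ℕ → ℝ → EuclideanSpace ℝ (Fin 3) → EuclideanSpace ℝ (Fin 3), (∀ k, Us k ∈ Ω) →
      ∃ (φ : ℕ → ℕ) (U : ℝ → EuclideanSpace ℝ (Fin 3) → EuclideanSpace ℝ (Fin 3)), StrictMono φ ∧ U ∈ Ω ∧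
        (∀ t < 0, TendstoLocallyUniformly (fun j => Us (φ j) t) (U t) atTop) ∧
        TendstoLocallyUniformly (fun j => curl (Us (φ j) (-1))) (curl (U (-1))) atTop := by
    intro Us hUs
    have hN : ∀ k, Us k (-1) 0 2 = Us 0 (-1) 0 2 := fun k => by
      obtain ⟨hPk, -, τk, -, hVk, -⟩ := hUs k
      obtain ⟨hP0', -, τ0', -, hV0', -⟩ := hUs 0
      rw [hull_hot_value hhot hPk (hVk (-1) (by norm_num)), hull_hot_value hhot hP0' (hV0' (-1) (by norm_num))]
    obtain ⟨φ, U, hφ, hPU, hKU, hsl, hcu⟩ := classCompactness C Us (fun k => (hUs k).1) (fun k => (hUs k).2.1) hN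
    choose τss hτss hVj hWj using fun j => (hUs (φ j)).2.2
    obtain ⟨τs, hτs, hV, hW⟩ := hull_diagonal hl hP (Ws := fun j => Us (φ j)) (τss := τss) (fun j => (hUs (φ j)).1)
      hτss hVj hWj hPU hsl hcu
    exact ⟨φ, U, hφ, ⟨hPU, hKU, τs, hτs, hV, hW⟩, hsl, hcu⟩
  -- Birkhoff recurrence in the hull
  obtain ⟨U, hUΩ, γU, hγU0, hγU, hrec⟩ := exists_uniformly_recurrent C Ω ⟨U0, hU0⟩ hcls hcpt hinv
  obtain ⟨hPU, hKU, τs, hτs, hVt, hW⟩ := hUΩ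
  obtain ⟨KU, BU, hKU', hBU⟩ := curl_slice_bounded_lipschitz hPU.1 hPU.2.1 hPU.2.2.1 hPU.2.2.2.1 (by norm_num : (-1 : ℝ) < 0)
  obtain ⟨hhotU, hreb⟩ := hull_leaf hP hγ hhot hPU (hVt (-1) (by norm_num)) hW hγU0 hγU
  -- the end vorticity persists along the limit leaf
  have hτsσ : ∀ σ : ℝ, Tendsto (fun k => τs k + σ) atTop l := fun σ => by
    rcases hl with rfl | rfl
    · exact tendsto_atTop_add_const_right _ σ hτs
    · exact tendsto_atBot_add_const_right _ σ hτs
  have h9 : ∀ σ : ℝ, δ ≤ ‖curl (U (-1)) (γU σ)‖ := by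
    intro σ
    have h1 : Tendsto (fun k => curl (v (-1)) ((γ (τs k + σ) - γ (τs k)) + γ (τs k))) atTop (𝓝 (curl (U (-1)) (γU σ))) :=
      hW.tendsto_comp hKU'.continuous.continuousAt (hreb σ)
    have h2 : (fun k => curl (v (-1)) ((γ (τs k + σ) - γ (τs k)) + γ (τs k))) = fun k => curl (v (-1)) (γ (τs k + σ)) := by
      funext k
      rw [sub_add_cancel]
    rw [h2] at h1
    exact ge_of_tendsto ((continuous_norm.tendsto _).comp h1) ((hτsσ σ).eventually hpers)
  -- the returns of the `(1/(m+1), slab m)`-recurrence, forward and backward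
  have hret := fun m : ℕ => hrec (1 / ((m : ℝ) + 1)) (by positivity) m
  choose L hL hwin using hret
  choose σp hσp hσp1 hσp2 using fun m : ℕ => hwin m (m : ℝ)
  choose σm hσm hσm1 hσm2 using fun m : ℕ => hwin m (-(m : ℝ) - L m)
  refine ⟨U, γU, τs, hτs, hPU, hKU, hVt, hW, hγU0, hγU, hhotU, h9, ?_, ?_, ?_⟩
  · obtain ⟨hsl, hcu, hrb⟩ := recurrent_returns hKU' hBU hγU0 hγU (σs := σp) (fun m => ⟨hσp1 m, hσp2 m⟩)
    refine ⟨σp, ?_, hsl, hcu, hrb⟩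
    exact tendsto_atTop_mono (fun m => (hσp m).1) tendsto_natCast_atTop_atTop
  · obtain ⟨hsl, hcu, hrb⟩ := recurrent_returns hKU' hBU hγU0 hγU (σs := σm) (fun m => ⟨hσm1 m, hσm2 m⟩)
    refine ⟨σm, ?_, hsl, hcu, hrb⟩
    refine tendsto_atBot_mono (fun m => ?_) (tendsto_neg_atTop_atBot.comp tendsto_natCast_atTop_atTop)
    have := (hσm m).2
    show σm m ≤ -(m : ℝ)
    linarith
  · intro ε hε R hR
    obtain ⟨n, hn⟩ := exists_nat_ge R
    have hRn : R ≤ (n : ℝ) + 2 := by linarith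
    obtain ⟨L, hL, hwin⟩ := hrec ε hε n
    refine ⟨L, hL, fun a => ?_⟩
    obtain ⟨σ, hσ, h1, -⟩ := hwin a
    refine ⟨σ, hσ, fun t ht x hx => (h1 t ⟨by linarith [ht.1], le_trans ht.2 ?_⟩ x (closedBall_subset_closedBall hRn hx)).le⟩
    rw [neg_le_neg_iff]
    exact inv_anti₀ hR hRn

end Summit.NavierStokesRegularity.NavierStokesRegularity.Theorems.PoloidalWindowDoorPoloidalWindowRigidityHotHullLeafRecurrence

end
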